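import Summits.KontsevichZagierPeriods.KontsevichZagierPeriods.Theorems.K2SymbolChainsJensenIsScissorsLastCoord

/-!
# Jensen is scissors — toolkit V: pieces of signed unfolding domains, the fibrewise dilation

Support file for item stmt-KontsevichZagierPeriods-5204 (`JensenIsScissors`, route
KontsevichZagierPeriods/K2SymbolChains): set identities for the signed unfolding domains
`KZ.logUnfoldDomain` (restricting the base; the one-sheeted cases `W ≥ 1`, `W ≤ 1`), splitting a
representation along two pieces covering its domain up to null sets, the value of a Fréchet
derivative on `e_last` as the derivative along the last coordinate, and the differentiability /
`u`-derivative / semialgebraicity of the fibrewise dilation `(b, u) ↦ K(b) · u`.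
[Kontsevich–Zagier 2001, §1.1–1.2] [folklore]
-/

noncomputable section

open MeasureTheory Set
open Literature.NumberTheory.Transcendental Literature.ModelTheory.ExponentialFields

namespace Summit.KontsevichZagierPeriods.K2SymbolChains.JensenIsScissorsProof

open Literature.NumberTheory.Transcendental.KZ

variable {m : ℕ} {S : AddSubgroup FormalRep}

/-! ### Set identities for signed unfolding domains -/

/-- Restricting the base of a signed unfolding domain. [folklore] -/
theorem logUnfoldDomain_inter_cyl (T P : Set (Fin m → ℝ)) (W : (Fin m → ℝ) → ℝ) :
    logUnfoldDomain T W ∩ {z | Fin.init z ∈ P} = logUnfoldDomain (T ∩ P) W := by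
  ext z
  simp only [logUnfoldDomain, mem_inter_iff, mem_setOf_eq]
  tauto

/-- Removing part of the base of a signed unfolding domain. [folklore] -/
theorem logUnfoldDomain_diff_cyl (T P : Set (Fin m → ℝ)) (W : (Fin m → ℝ) → ℝ) :
    logUnfoldDomain T W \ {z | Fin.init z ∈ P} = logUnfoldDomain (T \ P) W := by
  ext z
  simp only [logUnfoldDomain, mem_sdiff, mem_setOf_eq]
  tauto

/-- Over a base where `W ≥ 1` only the positive sheet `1 < u < W` is present. [folklore] -/
theorem logUnfoldDomain_eq_of_one_le {T : Set (Fin m → ℝ)} {W : (Fin m → ℝ) → ℝ}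
    (h : ∀ b ∈ T, 1 ≤ W b) :
    logUnfoldDomain T W = {z : Fin (m + 1) → ℝ | Fin.init z ∈ T ∧ (fun _ => (1 : ℝ)) (Fin.init z) <
      z (Fin.last m) ∧ z (Fin.last m) < W (Fin.init z)} := by
  ext z
  simp only [logUnfoldDomain, mem_setOf_eq]
  constructor
  · rintro ⟨hb, h1 | h1⟩
    · exact ⟨hb, h1⟩
    · exact absurd (h1.1.trans h1.2) (not_lt.2 (h _ hb))
  · rintro ⟨hb, h1⟩
    exact ⟨hb, Or.inl h1⟩

/-- Over a base where `W ≤ 1` only the negative sheet `W < u < 1` is present. [folklore] -/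
theorem logUnfoldDomain_eq_of_le_one {T : Set (Fin m → ℝ)} {W : (Fin m → ℝ) → ℝ}
    (h : ∀ b ∈ T, W b ≤ 1) :
    logUnfoldDomain T W = {z : Fin (m + 1) → ℝ | Fin.init z ∈ T ∧ W (Fin.init z) < z (Fin.last m) ∧
      z (Fin.last m) < (fun _ => (1 : ℝ)) (Fin.init z)} := by
  ext z
  simp only [logUnfoldDomain, mem_setOf_eq]
  constructor
  · rintro ⟨hb, h1 | h1⟩
    · exact absurd (h1.1.trans h1.2) (not_lt.2 (h _ hb))
    · exact ⟨hb, h1⟩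
  · rintro ⟨hb, h1⟩
    exact ⟨hb, Or.inr h1⟩

/-! ### Covering a domain by two pieces up to null sets -/

/-- Splitting a representation along two semialgebraic subsets of its domain with null overlap which
cover it up to a null set. [Kontsevich–Zagier 2001, §1.2, rule 1)] [folklore] -/
theorem of_sub_restrict_sub_restrict_mem_of_null
    (hS : domainAddRel ∪ integrandAddRel ∪ changeOfVariablesRel ⊆ S) {N : ℕ} (r : IntegralRep N)
    {A B : Set (Fin N → ℝ)} (hA : IsSemialgebraic ℚ A) (hB : IsSemialgebraic ℚ B)
    (hAr : A ⊆ r.domain) (hBr : B ⊆ r.domain) (hnull : volume (A ∩ B) = 0)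
    (hcover : volume (r.domain \ (A ∪ B)) = 0) :
    of r - of (r.restrict A hA hAr) - of (r.restrict B hB hBr) ∈ S := by
  set r₀ := r.restrict (A ∪ B) (hA.union hB) (union_subset hAr hBr) with hr₀
  have h1 : of r - of r₀ ∈ S :=
    of_sub_of_mem_of_subset hS (union_subset hAr hBr) (by simpa [hr₀] using hcover) (fun _ _ => rfl)
  have h2 : of r₀ - of (r.restrict A hA hAr) - of (r.restrict B hB hBr) ∈ S :=
    of_sub_of_sub_mem_of_union hS rfl (by simpa using hnull) (fun _ _ => rfl) (fun _ _ => rfl)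
  have : of r - of (r.restrict A hA hAr) - of (r.restrict B hB hBr) =
      (of r - of r₀) + (of r₀ - of (r.restrict A hA hAr) - of (r.restrict B hB hBr)) := by abel
  rw [this]
  exact S.add_mem h1 h2

/-! ### Directional derivative along the last coordinate; the fibrewise dilation `u ↦ K(b) u` -/

/-- **The value of a Fréchet derivative on `e_last` is the derivative along the last coordinate.**
[folklore] -/
theorem fderiv_apply_single_last {F : (Fin (m + 1) → ℝ) → ℝ} {L : (Fin (m + 1) → ℝ) →L[ℝ] ℝ}
    {z : Fin (m + 1) → ℝ} (hF : HasFDerivAt F L z) {d : ℝ}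
    (hd : HasDerivAt (fun t : ℝ => F (Fin.snoc (Fin.init z) t)) d (z (Fin.last m))) :
    L (Pi.single (Fin.last m) 1) = d := by
  -- the line `t ↦ (init z, t)` through `z`
  have hline : ∀ t : ℝ, (Fin.snoc (Fin.init z) t : Fin (m + 1) → ℝ) =
      (Fin.snoc (Fin.init z) 0 : Fin (m + 1) → ℝ) + t • (Pi.single (Fin.last m) (1 : ℝ)) := by
    intro t
    funext i
    refine Fin.lastCases ?_ (fun j => ?_) i
    · simp
    · simp [(Fin.castSucc_lt_last j).ne]
  have hγ : HasDerivAt (fun t : ℝ => (Fin.snoc (Fin.init z) t : Fin (m + 1) → ℝ))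
      (Pi.single (Fin.last m) (1 : ℝ)) (z (Fin.last m)) := by
    have h := ((hasDerivAt_id (z (Fin.last m))).smul_const (Pi.single (Fin.last m) (1 : ℝ))).const_add
      (Fin.snoc (Fin.init z) 0 : Fin (m + 1) → ℝ)
    simp only [one_smul] at h
    refine h.congr_of_eventuallyEq (Filter.Eventually.of_forall fun t => ?_)
    simp only [hline t, id_eq]
  have hz : (Fin.snoc (Fin.init z) (z (Fin.last m)) : Fin (m + 1) → ℝ) = z := Fin.snoc_init_self z
  have hF' : HasFDerivAt F L (Fin.snoc (Fin.init z) (z (Fin.last m))) := by rwa [hz]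
  have hcomp : HasDerivAt (fun t : ℝ => F (Fin.snoc (Fin.init z) t)) (L (Pi.single (Fin.last m) 1))
      (z (Fin.last m)) := hF'.comp_hasDerivAt (z (Fin.last m)) hγ
  exact hcomp.unique hd

/-- The dilation `z ↦ K (init z) · z last` is differentiable at a point over which `K` is.
[folklore] -/
theorem differentiableAt_dilation {K : (Fin m → ℝ) → ℝ} {z : Fin (m + 1) → ℝ}
    (hK : DifferentiableAt ℝ K (Fin.init z)) :
    DifferentiableAt ℝ (fun w : Fin (m + 1) → ℝ => K (Fin.init w) * w (Fin.last m)) z := by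
  have h1 : DifferentiableAt ℝ (fun w : Fin (m + 1) → ℝ => Fin.init w) z :=
    (ContinuousLinearMap.pi fun j => ContinuousLinearMap.proj (R := ℝ)
      (φ := fun _ : Fin (m + 1) => ℝ) (Fin.castSucc j)).differentiableAt
  exact (hK.comp z h1).mul (differentiableAt_apply (Fin.last m) z)

/-- The `u`-derivative of the dilation is `K (init z)`. [folklore] -/
theorem fderiv_dilation_single {K : (Fin m → ℝ) → ℝ} {z : Fin (m + 1) → ℝ}
    (hK : DifferentiableAt ℝ K (Fin.init z)) :
    fderiv ℝ (fun w : Fin (m + 1) → ℝ => K (Fin.init w) * w (Fin.last m)) z (Pi.single (Fin.last m) 1) =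
      K (Fin.init z) := by
  refine fderiv_apply_single_last (differentiableAt_dilation hK).hasFDerivAt ?_
  simp only [Fin.init_snoc, Fin.snoc_last]
  simpa using (hasDerivAt_id (z (Fin.last m))).const_mul (K (Fin.init z))

/-- The dilation `z ↦ K (init z) · z last` is `ℚ`-semialgebraic on any `ℚ`-semialgebraic set over a
base on which `K` is. [BCR 1998, Prop. 2.2.6] [folklore] -/
theorem isSemialgebraicFunOn_dilation {T : Set (Fin m → ℝ)} {K : (Fin m → ℝ) → ℝ}
    (hK : IsSemialgebraicFunOn ℚ T K) {D : Set (Fin (m + 1) → ℝ)} (hD : IsSemialgebraic ℚ D)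
    (hDT : D ⊆ {z | Fin.init z ∈ T}) :
    IsSemialgebraicFunOn ℚ D (fun w : Fin (m + 1) → ℝ => K (Fin.init w) * w (Fin.last m)) :=
  IsSemialgebraicFunOn.mul_holds (hK.comp_init.mono hDT hD) (isSemialgebraicFunOn_apply hD (Fin.last m))

/-! ### Extending a representation by a null set -/

/-- **Extension by a null set.** If `r.domain ⊆ D` with `D` `ℚ`-semialgebraic, `D \ r.domain`
null, and `f` is `ℚ`-semialgebraic on `D` and agrees with `r.integrand` on `r.domain`, then there is
a representation on `D` with integrand `f`, differing from `r` by an element of `S`.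
[Kontsevich–Zagier 2001, §1.2, rule 1)] [folklore] -/
theorem exists_extend_null (hS : domainAddRel ∪ integrandAddRel ∪ changeOfVariablesRel ⊆ S)
    {N : ℕ} (r : IntegralRep N) {D : Set (Fin N → ℝ)} (hD : IsSemialgebraic ℚ D)
    (hsub : r.domain ⊆ D) (hnull : volume (D \ r.domain) = 0) {f : (Fin N → ℝ) → ℝ}
    (hf : IsSemialgebraicFunOn ℚ D f) (heq : EqOn f r.integrand r.domain) :
    ∃ r' : IntegralRep N, r'.domain = D ∧ r'.integrand = f ∧ of r' - of r ∈ S := by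
  have hm : MeasurableSet r.domain := IntegralRep.measurableSet_domain_holds r
  have h1 : IntegrableOn f r.domain := r.integrableOn.congr_fun (fun x hx => (heq hx).symm) hm
  have h2 : IntegrableOn f (D \ r.domain) := by
    rw [IntegrableOn, Measure.restrict_eq_zero.2 hnull]
    exact integrable_zero_measure
  have hint : IntegrableOn f D := by
    rw [← union_sdiff_cancel hsub]
    exact h1.union h2
  refine ⟨⟨D, f, hD, hf, hint⟩, rfl, rfl, ?_⟩
  exact of_sub_of_mem_of_subset hS hsub hnull heq

end Summit.KontsevichZagierPeriods.K2SymbolChains.JensenIsScissorsProof
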